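import Summits.MatrixMultiplication.OmegaCensus.SmallFormats.MatMul226GF3NoIPReduction
import Summits.MatrixMultiplication.OmegaCensus.SmallFormats.InvertiblePointHalfLaw
import HarnessLib

/-!
# ω-census family (a): the HALF LAW as a cap on the `𝔽₃` X-marginal, and the rung candidate `37 ≤ R_𝔽₃(⟨2,2,11⟩)`

Cell `pub-omega` (unit `pub-omega-tensor`, gen 35), topic `Summits/MatrixMultiplication/OmegaCensus` (sub-folder
`SmallFormats`). Framing (verbatim): lottery ticket; floor = certified bounds/negative ranges. HONEST FRAMING: bookkeeping on top of
the X-marginal census reduction (`MatMul22nGF3MarginalCensus`, tensor g30; `MatMul226GF3NoIPReduction`, tensor g34) and the kernel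
HALF LAW (`InvertiblePointHalfLaw`, p666834, this generation): at every invertible `X₀` of an `r`-product `𝔽₃`-scheme for `⟨2,2,n⟩`,
`11n + 2·#{i : m_i ⊥ X₀} ≤ 4r` (`invLineCapHalf_xMarginal`), so the enumeration universe of the census may be cut to the
marginals obeying this cap (`succ_le_tensorRank_22n_gf3_of_half_enumeration`). At the floor rung `(n, r) = (11, 36)` the cap reads
'at most 11 of the 36 coefficient matrices are orthogonal to any invertible `X₀`' (the plain cap allows 14), and
(`thirtyseven_le_tensorRank_2211_gf3_of_empty`) IF no nowhere-zero marginal in `XCaps3 11 36` obeys it — a finite statement about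
`𝔽₃`-vectors of 36 classes; desk/kit evidence (tensor g35): the class-count system is integrally infeasible (z3 + scipy-milp, kit
j317528/j317780) and tensor g31's WLOG DFS re-capped has 988 225 nodes and 0 leaves — THEN `37 ≤ R_𝔽₃(⟨2,2,11⟩)`, one above the
kernel floor `36`. The emptiness is NOT proved here (it is the enumeration certificate still to be produced in kernel); nothing here
is unconditional beyond the cap, and nothing is a bound on `ω`.
-/

namespace Summit.MatrixMultiplication.OmegaCensus.RankOnePlaneCapGeneral

open Module Matrix Literature.Computability.AlgebraicComplexity
open Summit.MatrixMultiplication.OmegaCensus.SmallFormats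

variable {n : ℕ}

/-- **The half law as a cap on the X-marginal** (`𝔽₃`, any `(n, r)`): at every invertible `X₀`,
`11n + 2·#{i : m_i ⊥ X₀} ≤ 4r` for the X-marginal `m` of an `r`-product computation of `⟨2,2,n⟩`. -/
theorem invLineCapHalf_xMarginal {r : ℕ} (β : BilinComp (mulBilin (ZMod 3) 2 2 n) (Fin r))
    (X₀ : Matrix (Fin 2) (Fin 2) (ZMod 3)) (hX₀ : X₀.det ≠ 0) :
    11 * n + 2 * (Finset.univ.filter fun i => dotX (mflat (xMarginal β i)) X₀ = 0).card ≤ 4 * r := by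
  have h1 := NearSplit.eleven_mul_le β X₀ (isUnit_iff_ne_zero.mpr hX₀)
  rw [Fintype.card_fin] at h1
  change 11 * n ≤ 2 * r + 2 * (Finset.univ.filter fun i => ¬ β.f i X₀ = 0).card at h1
  have hsplit := Finset.card_filter_add_card_filter_not (s := (Finset.univ : Finset (Fin r))) (fun i => β.f i X₀ = 0)
  rw [Finset.card_univ, Fintype.card_fin] at hsplit
  have hcongr : (Finset.univ.filter fun i => dotX (mflat (xMarginal β i)) X₀ = 0) =
      Finset.univ.filter fun i => β.f i X₀ = 0 := by
    refine Finset.filter_congr fun i _ => ?_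
    rw [f_apply_eq_dotX]
  rw [hcongr]
  omega

/-- **Census reduction with the half-law universe** (`𝔽₃`, floor rung `r ≤ R_𝔽₃(⟨2,2,n⟩)`): IF every nowhere-zero `m` in
`XCaps3 n r` satisfying the half-law cap at every invertible `X₀` is `InOrbit`-related to a member of `Reps`, AND no member of `Reps`
is an X-marginal, THEN `r + 1 ≤ R_𝔽₃(⟨2,2,n⟩)`. Both hypotheses are engine-side; the cap is kernel. -/
theorem succ_le_tensorRank_22n_gf3_of_half_enumeration (r : ℕ) (hr : r ≤ tensorRank (matMulTensor (ZMod 3) 2 2 n))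
    (Reps : Set (Fin r → Matrix (Fin 2) (Fin 2) (ZMod 3)))
    (henum : ∀ m : Fin r → Matrix (Fin 2) (Fin 2) (ZMod 3), (∀ i, m i ≠ 0) → XCaps3 n r m →
      (∀ X₀ : Matrix (Fin 2) (Fin 2) (ZMod 3), X₀.det ≠ 0 →
        11 * n + 2 * (Finset.univ.filter fun i => dotX (mflat (m i)) X₀ = 0).card ≤ 4 * r) →
      ∃ rep ∈ Reps, InOrbit m rep)
    (hexcl : ∀ rep ∈ Reps, ∀ β : BilinComp (mulBilin (ZMod 3) 2 2 n) (Fin r), xMarginal β ≠ rep) :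
    r + 1 ≤ tensorRank (matMulTensor (ZMod 3) 2 2 n) :=
  succ_le_tensorRank_22n_of_orbit_census r Reps
    (fun β => henum _ (xMarginal_ne_zero_of_le_tensorRank hr β) (xCaps3_xMarginal β)
      (fun X₀ hX₀ => invLineCapHalf_xMarginal β X₀ hX₀)) hexcl

/-- **Rung candidate `37 ≤ R_𝔽₃(⟨2,2,11⟩)` reduced to a finite emptiness statement.** With the kernel floor `36 ≤ R_𝔽₃(⟨2,2,11⟩)`
and the kernel half law (at `(11, 36)`: at most `11` coefficient matrices orthogonal to any invertible `X₀`): IF no nowhere-zero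
`m : Fin 36 → 𝔽₃^{2×2}` lies in `XCaps3 11 36` with `#{i : m_i ⊥ X₀} ≤ 11` for every invertible `X₀`, THEN `37 ≤ R_𝔽₃(⟨2,2,11⟩)`.
The emptiness hypothesis is NOT proved here (desk: class-count system integrally infeasible; WLOG DFS 988 225 nodes, 0 leaves). -/
theorem thirtyseven_le_tensorRank_2211_gf3_of_empty
    (hempty : ∀ m : Fin 36 → Matrix (Fin 2) (Fin 2) (ZMod 3), (∀ i, m i ≠ 0) → XCaps3 11 36 m →
      (∀ X₀ : Matrix (Fin 2) (Fin 2) (ZMod 3), X₀.det ≠ 0 →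
        (Finset.univ.filter fun i => dotX (mflat (m i)) X₀ = 0).card ≤ 11) → False) :
    37 ≤ tensorRank (matMulTensor (ZMod 3) 2 2 11) := by
  refine succ_le_tensorRank_22n_gf3_of_half_enumeration 36
    (by have h := (tensorRank_matMulTensor_22n_gf3_window 11 (by norm_num)).1; omega) ∅ ?_ (fun rep hrep => absurd hrep (by simp))
  intro m hm hcaps hhalf
  exact (hempty m hm hcaps fun X₀ hX₀ => by have h := hhalf X₀ hX₀; omega).elim

/-- The same with the window's ceiling: under the emptiness hypothesis `R_𝔽₃(⟨2,2,11⟩) ∈ {37, 38, 39}`. -/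
theorem tensorRank_2211_gf3_mem_of_empty
    (hempty : ∀ m : Fin 36 → Matrix (Fin 2) (Fin 2) (ZMod 3), (∀ i, m i ≠ 0) → XCaps3 11 36 m →
      (∀ X₀ : Matrix (Fin 2) (Fin 2) (ZMod 3), X₀.det ≠ 0 →
        (Finset.univ.filter fun i => dotX (mflat (m i)) X₀ = 0).card ≤ 11) → False) :
    37 ≤ tensorRank (matMulTensor (ZMod 3) 2 2 11) ∧ tensorRank (matMulTensor (ZMod 3) 2 2 11) ≤ 39 :=
  ⟨thirtyseven_le_tensorRank_2211_gf3_of_empty hempty,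
    by have h := (tensorRank_matMulTensor_22n_gf3_window 11 (by norm_num)).2; omega⟩

end Summit.MatrixMultiplication.OmegaCensus.RankOnePlaneCapGeneral
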